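import Summits.CriticalPhenomena.Ising3DConformalLimit.Theorems.PrecisionLaplacianEtaBoundsTransferFourier

/-!
# Pick inversion, auxiliary file 12: slabs of the Brillouin zone — Fubini along a coordinate,
# positivity of the symbol off the dual lattice, continuity of the slab transforms

Helper file for stub `stub_pickInversion` of line `self-energy-pick-inversion`, crux
`PrecisionLaplacian.DirectCorrelationStableTail` (stmt-CriticalPhenomena-4799). Pure theorem file.

* `setIntegral_cube_eq_slab` : `∫_{[-π,π]^{d+1}} F = ∫_{[-π,π]^d} (∫_{[-π,π]} F(ins_i(θ, k)) dθ) dk`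
  (`MeasurableEquiv.piFinSuccAbove` is volume preserving);
* `symbol_lt_one_of_not_mem_lattice` : if the
  Green function of the step law `q` is positive at the unit vectors, its symbol
  `φ(ξ) = ∑ q(y) cos(ξ·y)` is `< 1` at every `ξ` with a coordinate outside `2πℤ` (where `φ(ξ) = 1`,
  `q` and hence all convolution powers and the Green function live on the sublattice
  `{x : cos(ξ·x) = 1}`);
* `continuousAt_slab_transform` : `k ↦ ∫_{-π}^{π} cos(nθ)/Φ(ins_i(θ,k)) dθ` is continuous at `k₀`
  when `Φ` is continuous and positive on `[-π,π] × (a ball around k₀)`;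
* `hasSum_symbol_slab` (registered sub-goal `stub_pickInversion_auxSymbolSlab`): for `q` symmetric
  under the reflection of the `i`-th coordinate,
  `1 - φ(ins_i(θ, k₀)) = (1 - α₀) - 2 ∑_{n ≥ 1} αₙ cos(nθ)` with the slab modes
  `αₙ = ∑_{y ∈ ℤ²} q(ins_i(n, y)) cos(k₀·y)` (regrouping `ℤ³ = ℤ × ℤ²`, pairing `n` with `-n`).
-/

noncomputable section

namespace Summit.CriticalPhenomena.Ising3DConformalLimit.Cruxes.DirectCorrelationStableTail.SelfEnergyPickInversion

open Filter Topology Finset Real MeasureTheory Literature.Probability.LatticeModels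
open scoped BigOperators ENNReal
open Summit.CriticalPhenomena.Ising3DConformalLimit.Theorems.EtaBoundsTransfer
  (continuous_phase abs_fourier_q_le_one)

/-! ### Fubini along one coordinate of the Brillouin zone -/

/-- **Slab decomposition of the Brillouin zone.** For `F` integrable on `[-π,π]^{d+1}` and a
coordinate `i`,
`∫_{[-π,π]^{d+1}} F(ξ) dξ = ∫_{[-π,π]^d} (∫_{[-π,π]} F(Fin.insertNth i θ k) dθ) dk`. [folklore] -/
theorem setIntegral_cube_eq_slab {d : ℕ} (i : Fin (d + 1)) {F : (Fin (d + 1) → ℝ) → ℝ}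
    (hF : IntegrableOn F (Set.pi Set.univ (fun _ : Fin (d + 1) => Set.Icc (-π) π)) volume) :
    IntegrableOn (fun k : Fin d → ℝ => ∫ θ in Set.Icc (-π) π, F (Fin.insertNth i θ k))
        (Set.pi Set.univ (fun _ : Fin d => Set.Icc (-π) π)) volume ∧
    ∫ ξ in Set.pi Set.univ (fun _ : Fin (d + 1) => Set.Icc (-π) π), F ξ =
      ∫ k in Set.pi Set.univ (fun _ : Fin d => Set.Icc (-π) π),
        ∫ θ in Set.Icc (-π) π, F (Fin.insertNth i θ k) := by
  set e := MeasurableEquiv.piFinSuccAbove (fun _ : Fin (d + 1) => ℝ) i with he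
  have hmp : MeasurePreserving e volume volume := volume_preserving_piFinSuccAbove (fun _ => ℝ) i
  have he_symm : ∀ aq : ℝ × (Fin d → ℝ), e.symm aq = Fin.insertNth i aq.1 aq.2 := fun aq => rfl
  have he_apply : ∀ p : Fin (d + 1) → ℝ, e p = (p i, fun j => p (i.succAbove j)) := fun p => rfl
  have hpre : e ⁻¹' (Set.Icc (-π) π ×ˢ Set.pi Set.univ (fun _ : Fin d => Set.Icc (-π) π)) =
      Set.pi Set.univ (fun _ : Fin (d + 1) => Set.Icc (-π) π) := by
    ext p
    simp only [Set.mem_preimage, he_apply, Set.mem_prod, Set.mem_univ_pi]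
    rw [Fin.forall_iff_succAbove i]
  -- transport the integral
  have h1 : ∫ ξ in Set.pi Set.univ (fun _ : Fin (d + 1) => Set.Icc (-π) π), F ξ =
      ∫ aq in Set.Icc (-π) π ×ˢ Set.pi Set.univ (fun _ : Fin d => Set.Icc (-π) π), F (e.symm aq) := by
    rw [← hpre]
    have := hmp.setIntegral_preimage_emb e.measurableEmbedding (fun aq => F (e.symm aq))
      (Set.Icc (-π) π ×ˢ Set.pi Set.univ (fun _ : Fin d => Set.Icc (-π) π))
    simp only [MeasurableEquiv.symm_apply_apply] at this
    exact this
  -- integrability on the product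
  have h2 : IntegrableOn (fun aq => F (e.symm aq))
      (Set.Icc (-π) π ×ˢ Set.pi Set.univ (fun _ : Fin d => Set.Icc (-π) π)) volume := by
    rw [← hpre] at hF
    refine (hmp.integrableOn_comp_preimage e.measurableEmbedding (f := fun aq => F (e.symm aq))).1 ?_
    simpa only [Function.comp_def, MeasurableEquiv.symm_apply_apply] using hF
  rw [IntegrableOn, Measure.volume_eq_prod, ← Measure.prod_restrict] at h2
  constructor
  · have h3 := h2.integral_prod_right
    simp only [he_symm] at h3
    exact h3
  rw [h1, Measure.volume_eq_prod, ← Measure.prod_restrict, integral_prod_symm]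
  · simp only [he_symm]
  · exact h2

/-! ### Positivity of the symbol off the dual lattice -/

/-- `cos a = 1` and `cos b = 1` imply `cos (a + b) = 1` and `cos (a - b) = 1`. [folklore] -/
theorem cos_add_sub_eq_one {a b : ℝ} (ha : Real.cos a = 1) (hb : Real.cos b = 1) :
    Real.cos (a + b) = 1 ∧ Real.cos (a - b) = 1 := by
  have hsa : Real.sin a = 0 := by
    have := Real.sin_sq_add_cos_sq a; rw [ha] at this; nlinarith
  have hsb : Real.sin b = 0 := by
    have := Real.sin_sq_add_cos_sq b; rw [hb] at this; nlinarith
  rw [Real.cos_add, Real.cos_sub, ha, hb, hsa, hsb]; norm_num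

/-- **The symbol is `< 1` off the dual lattice.** Let `q ≥ 0` be summable on `ℤ^d` with `∑ q ≤ 1`,
with convolution powers `P` and Green function `G = ∑_j P j`, positive at the unit vectors. If a
coordinate of `ξ` is not in `2πℤ` then `φ(ξ) = ∑ q(y) cos(ξ·y) < 1`. [folklore] -/
theorem symbol_lt_one_of_not_mem_lattice {d : ℕ} {q : Site d → ℝ} {P : ℕ → Site d → ℝ}
    (hq0 : ∀ y, 0 ≤ q y) (hqs : Summable q) (hq1 : ∑' y, q y ≤ 1)
    (hP0 : ∀ z, P 0 z = if z = 0 then 1 else 0)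
    (hPs : ∀ j z, P (j + 1) z = ∑' y, q y * P j (z - y))
    {G : Site d → ℝ} (hGreen : ∀ z, HasSum (fun j => P j z) (G z))
    (hGpos : ∀ m : Fin d, 0 < G (Pi.single m 1)) {ξ : Fin d → ℝ}
    (hξ : ∃ m : Fin d, ∀ z : ℤ, ξ m ≠ z * (2 * π)) :
    ∑' y, q y * Real.cos (phase d ξ y) < 1 := by
  obtain ⟨m, hm⟩ := hξ
  have hle : ∑' y, q y * Real.cos (phase d ξ y) ≤ 1 := (abs_le.1 (abs_fourier_q_le_one hq0 hqs hq1 ξ)).2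
  refine lt_of_le_of_ne hle fun heq => ?_
  -- every `y` with `q y > 0` has `cos(ξ·y) = 1`
  have hsumm : Summable fun y => q y * (1 - Real.cos (phase d ξ y)) :=
    Summable.of_norm_bounded (hqs.mul_right 2) fun y => by
      rw [Real.norm_eq_abs, abs_mul, abs_of_nonneg (hq0 y)]
      refine mul_le_mul_of_nonneg_left ?_ (hq0 y)
      have := Real.neg_one_le_cos (phase d ξ y); have := Real.cos_le_one (phase d ξ y)
      rw [abs_le]; constructor <;> linarith
  have hnn : ∀ y, 0 ≤ q y * (1 - Real.cos (phase d ξ y)) :=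
    fun y => mul_nonneg (hq0 y) (by linarith [Real.cos_le_one (phase d ξ y)])
  have hzero : ∀ y, q y * (1 - Real.cos (phase d ξ y)) = 0 := by
    have hcs : Summable fun y => q y * Real.cos (phase d ξ y) :=
      Summable.of_norm_bounded hqs fun y => by
        rw [Real.norm_eq_abs, abs_mul, abs_of_nonneg (hq0 y)]
        exact mul_le_of_le_one_right (hq0 y) (Real.abs_cos_le_one _)
    have htot : ∑' y, q y * (1 - Real.cos (phase d ξ y)) ≤ 0 := by
      have : (fun y => q y * (1 - Real.cos (phase d ξ y))) = fun y => q y - q y * Real.cos (phase d ξ y) := by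
        funext y; ring
      rw [this, hqs.tsum_sub hcs, heq]; linarith
    have h0 : ∑' y, q y * (1 - Real.cos (phase d ξ y)) = 0 := le_antisymm htot (tsum_nonneg hnn)
    have := hsumm.hasSum
    rw [h0] at this
    exact congr_fun ((hasSum_zero_iff_of_nonneg hnn).1 this)
  have hcos : ∀ y, 0 < q y → Real.cos (phase d ξ y) = 1 := by
    intro y hy
    have := hzero y
    rcases mul_eq_zero.1 this with h | h
    · exact absurd h hy.ne'
    · linarith
  -- the convolution powers live on `L = {x | cos(ξ·x) = 1}`
  have hsupp : ∀ j x, Real.cos (phase d ξ x) ≠ 1 → P j x = 0 := by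
    intro j
    induction j with
    | zero =>
      intro x hx
      rw [hP0, if_neg]
      rintro rfl
      exact hx (by simp [phase])
    | succ j ih =>
      intro x hx
      rw [hPs]
      have hterm : (fun y => q y * P j (x - y)) = fun _ => 0 := by
        funext y
        rcases (hq0 y).lt_or_eq with hq | hq
        · have hy := hcos y hq
          have hxy : Real.cos (phase d ξ (x - y)) ≠ 1 := by
            intro h
            apply hx
            have := (cos_add_sub_eq_one h hy).1
            rwa [phase_sub, sub_add_cancel] at this
          rw [ih _ hxy, mul_zero]
        · rw [← hq, zero_mul]
      rw [hterm, tsum_zero]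
  -- hence `G` vanishes off `L`, contradicting `G(e_m) > 0`
  have hGm : Real.cos (phase d ξ (Pi.single m 1)) = 1 := by
    by_contra h
    have h0 : G (Pi.single m 1) = 0 := by
      rw [← (hGreen _).tsum_eq]
      have : (fun j => P j (Pi.single m 1)) = fun _ => 0 := funext fun j => hsupp j _ h
      rw [this, tsum_zero]
    exact (hGpos m).ne' h0
  have hph : phase d ξ (Pi.single m 1) = ξ m := by
    simp [phase, Pi.single_apply]
  rw [hph, Real.cos_eq_one_iff] at hGm
  obtain ⟨z, hz⟩ := hGm
  exact hm z hz.symm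

/-! ### Continuity of the slab transforms -/

/-- **Continuity of a slab transform.** Let `Φ : ℝ^{d+1} → ℝ` be continuous and positive on
`{ins_i(θ, k) : θ ∈ [-π, π], k ∈ closedBall k₀ δ}` for some `δ > 0`. Then for every `n`,
`k ↦ ∫_{-π}^{π} cos(nθ)/Φ(ins_i(θ, k)) dθ` is continuous at `k₀`. [folklore] -/
theorem continuousAt_slab_transform {d : ℕ} (i : Fin (d + 1)) {Φ : (Fin (d + 1) → ℝ) → ℝ}
    (hΦ : Continuous Φ) {k₀ : Fin d → ℝ} {δ : ℝ} (hδ : 0 < δ)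
    (hpos : ∀ k ∈ Metric.closedBall k₀ δ, ∀ θ ∈ Set.Icc (-π) π, 0 < Φ (Fin.insertNth i θ k)) (n : ℕ) :
    ContinuousAt (fun k : Fin d → ℝ => ∫ θ in (-π)..π, Real.cos (n * θ) / Φ (Fin.insertNth i θ k)) k₀ := by
  have hπ := Real.pi_pos
  -- a uniform lower bound for `Φ` on the compact set
  set K : Set (ℝ × (Fin d → ℝ)) := Set.Icc (-π) π ×ˢ Metric.closedBall k₀ δ with hK
  have hKc : IsCompact K := isCompact_Icc.prod (isCompact_closedBall k₀ δ)
  have hKne : K.Nonempty := ⟨(0, k₀), ⟨by constructor <;> linarith, Metric.mem_closedBall_self hδ.le⟩⟩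
  have hins : Continuous fun p : ℝ × (Fin d → ℝ) => (Fin.insertNth i p.1 p.2 : Fin (d + 1) → ℝ) := by
    refine continuous_pi fun j => ?_
    refine Fin.succAboveCases i ?_ (fun j' => ?_) j
    · simp only [Fin.insertNth_apply_same]; exact continuous_fst
    · simp only [Fin.insertNth_apply_succAbove]; exact (continuous_apply j').comp continuous_snd
  have hcont : ContinuousOn (fun p : ℝ × (Fin d → ℝ) => Φ (Fin.insertNth i p.1 p.2)) K :=
    (hΦ.comp hins).continuousOn
  obtain ⟨p₀, hp₀K, hp₀⟩ := hKc.exists_isMinOn hKne hcont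
  set m : ℝ := Φ (Fin.insertNth i p₀.1 p₀.2) with hm
  have hmpos : 0 < m := hpos p₀.2 hp₀K.2 p₀.1 hp₀K.1
  have hmle : ∀ θ ∈ Set.Icc (-π) π, ∀ k ∈ Metric.closedBall k₀ δ, m ≤ Φ (Fin.insertNth i θ k) :=
    fun θ hθ k hk => (isMinOn_iff.mp hp₀) (θ, k) ⟨hθ, hk⟩
  -- dominated continuity
  have hball : Metric.ball k₀ δ ∈ 𝓝 k₀ := Metric.ball_mem_nhds k₀ hδ
  refine intervalIntegral.continuousAt_of_dominated_interval (bound := fun _ => 1 / m) ?_ ?_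
    intervalIntegrable_const ?_
  · refine Eventually.of_forall fun k => Measurable.aestronglyMeasurable ?_
    exact (by fun_prop : Measurable fun θ : ℝ => Real.cos (n * θ)).div
      (hΦ.measurable.comp (hins.comp (Continuous.prodMk continuous_id continuous_const)).measurable)
  · filter_upwards [hball] with k hk
    refine Eventually.of_forall fun θ hθ => ?_
    have hθ' : θ ∈ Set.Icc (-π) π := by
      rw [Set.uIoc_of_le (by linarith)] at hθ; exact ⟨hθ.1.le, hθ.2⟩
    have hΦk := hmle θ hθ' k (Metric.ball_subset_closedBall hk)
    rw [Real.norm_eq_abs, abs_div, abs_of_pos (lt_of_lt_of_le hmpos hΦk)]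
    calc |Real.cos (n * θ)| / Φ (Fin.insertNth i θ k) ≤ 1 / Φ (Fin.insertNth i θ k) :=
          div_le_div_of_nonneg_right (Real.abs_cos_le_one _) (lt_of_lt_of_le hmpos hΦk).le
      _ ≤ 1 / m := div_le_div_of_nonneg_left zero_le_one hmpos hΦk
  · refine Eventually.of_forall fun θ hθ => ?_
    have hθ' : θ ∈ Set.Icc (-π) π := by
      rw [Set.uIoc_of_le (by linarith)] at hθ; exact ⟨hθ.1.le, hθ.2⟩
    have hΦk₀ := hmle θ hθ' k₀ (Metric.mem_closedBall_self hδ.le)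
    refine ContinuousAt.div continuousAt_const ?_ (lt_of_lt_of_le hmpos hΦk₀).ne'
    exact (hΦ.comp (hins.comp (Continuous.prodMk continuous_const continuous_id))).continuousAt

/-! ### Slab decomposition of the phase and of lattice sums -/

/-- `ins_i(θ, k)·y = θ yᵢ + k·(y ∘ succAbove i)`. [folklore] -/
theorem phase_insertNth (i : Fin 3) (θ : ℝ) (k : Fin 2 → ℝ) (y : Site 3) :
    phase 3 (Fin.insertNth i θ k : Fin 3 → ℝ) y = θ * (y i : ℝ) + phase 2 k (fun j => y (i.succAbove j)) := by
  rw [phase, phase, Fin.sum_univ_succAbove _ i, Fin.insertNth_apply_same]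
  congr 1
  refine Finset.sum_congr rfl fun j _ => ?_
  rw [Fin.insertNth_apply_succAbove]

/-- `ins_i(n, y)` has `i`-th coordinate `n` and transverse coordinates `y`. [folklore] -/
theorem phase_insertNth_insertNth (i : Fin 3) (θ : ℝ) (k : Fin 2 → ℝ) (n : ℤ) (y : Fin 2 → ℤ) :
    phase 3 (Fin.insertNth i θ k : Fin 3 → ℝ) (Fin.insertNth i n y : Site 3) = θ * n + phase 2 k y := by
  rw [phase_insertNth, Fin.insertNth_apply_same]
  congr 1
  simp only [Fin.insertNth_apply_succAbove]

/-- The reflection of the `i`-th coordinate maps `ins_i(n, y)` to `ins_i(-n, y)`. [folklore] -/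
theorem update_insertNth_neg (i : Fin 3) (n : ℤ) (y : Fin 2 → ℤ) :
    Function.update (Fin.insertNth i n y : Site 3) i (-(Fin.insertNth i n y : Site 3) i) = Fin.insertNth i (-n) y := by
  ext j
  rcases Fin.eq_self_or_eq_succAbove i j with rfl | ⟨j', rfl⟩
  · simp [Fin.insertNth_apply_same]
  · rw [Function.update_of_ne (Fin.succAbove_ne i j')]
    simp [Fin.insertNth_apply_succAbove]

/-! ### The symbol on a slab as a cosine series -/

/-- **The precision symbol at fixed transverse momentum as a cosine series.** For an even-in-`i`
summable `q` on `ℤ³` and `k₀ ∈ ℝ²`, with `αₙ = ∑_{y} q(ins_i(n, y)) cos(k₀·y)`: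
`(αₙ)` is summable over `ℕ` and for every `θ`,
`∑_{n ≥ 0} cₙ cos(nθ) = 1 - ∑_x q(x) cos(ins_i(θ, k₀)·x)` with `c₀ = 1 - α₀`, `cₙ = -2αₙ` (`n ≥ 1`).
[folklore] -/
theorem hasSum_symbol_slab {q : Site 3 → ℝ} (hq0 : ∀ y, 0 ≤ q y) (hqs : Summable q)
    (i : Fin 3) (hqrefl : ∀ y : Site 3, q (Function.update y i (-y i)) = q y) (k₀ : Fin 2 → ℝ) :
    (Summable fun n : ℕ => ∑' y : Fin 2 → ℤ, q (Fin.insertNth i (n : ℤ) y) * Real.cos (phase 2 k₀ y)) ∧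
    ∀ θ : ℝ, HasSum (fun n : ℕ => (if n = 0 then 1 - ∑' y : Fin 2 → ℤ, q (Fin.insertNth i (0 : ℤ) y) * Real.cos (phase 2 k₀ y)
        else -2 * ∑' y : Fin 2 → ℤ, q (Fin.insertNth i (n : ℤ) y) * Real.cos (phase 2 k₀ y)) * Real.cos (n * θ))
      (1 - ∑' x : Site 3, q x * Real.cos (phase 3 (Fin.insertNth i θ k₀ : Fin 3 → ℝ) x)) := by
  -- the equivalence `ℤ × ℤ² ≃ ℤ³`
  set e : ℤ × (Fin 2 → ℤ) ≃ Site 3 := Fin.insertNthEquiv (fun _ => ℤ) i with he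
  have he_apply : ∀ p : ℤ × (Fin 2 → ℤ), e p = Fin.insertNth i p.1 p.2 := fun p => rfl
  -- summability of the slab family
  have hqs2 : Summable fun p : ℤ × (Fin 2 → ℤ) => q (Fin.insertNth i p.1 p.2) := by
    have := (e.summable_iff (f := q)).2 hqs
    simpa only [Function.comp_def, he_apply] using this
  set α : ℤ → ℝ := fun n => ∑' y : Fin 2 → ℤ, q (Fin.insertNth i n y) * Real.cos (phase 2 k₀ y) with hα
  set β : ℤ → ℝ := fun n => ∑' y : Fin 2 → ℤ, q (Fin.insertNth i n y) * Real.sin (phase 2 k₀ y) with hβ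
  have hrow : ∀ n : ℤ, Summable fun y : Fin 2 → ℤ => q (Fin.insertNth i n y) := fun n => hqs2.prod_factor n
  have hαabs : ∀ n : ℤ, |α n| ≤ ∑' y, q (Fin.insertNth i n y) := by
    intro n
    have hs : Summable fun y : Fin 2 → ℤ => q (Fin.insertNth i n y) * Real.cos (phase 2 k₀ y) :=
      Summable.of_norm_bounded (hrow n) fun y => by
        rw [Real.norm_eq_abs, abs_mul, abs_of_nonneg (hq0 _)]
        exact mul_le_of_le_one_right (hq0 _) (Real.abs_cos_le_one _)
    calc |α n| ≤ ∑' y, |q (Fin.insertNth i n y) * Real.cos (phase 2 k₀ y)| := by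
          have := norm_tsum_le_tsum_norm hs.norm; simpa only [Real.norm_eq_abs] using this
      _ ≤ ∑' y, q (Fin.insertNth i n y) := hs.abs.tsum_le_tsum (fun y => by
          rw [abs_mul, abs_of_nonneg (hq0 _)]
          exact mul_le_of_le_one_right (hq0 _) (Real.abs_cos_le_one _)) (hrow n)
  have hαsum : Summable α := Summable.of_norm_bounded hqs2.prod (fun n => by rw [Real.norm_eq_abs]; exact hαabs n)
  have hαsumN : Summable fun n : ℕ => α n := hαsum.comp_injective Nat.cast_injective
  -- reflection symmetry: `α (-n) = α n`
  have hqn : ∀ (n : ℤ) (y : Fin 2 → ℤ), q (Fin.insertNth i (-n) y) = q (Fin.insertNth i n y) := by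
    intro n y
    rw [← update_insertNth_neg i n y, hqrefl]
  have hαneg : ∀ n : ℤ, α (-n) = α n := fun n => tsum_congr fun y => by rw [hqn]
  have hβneg : ∀ n : ℤ, β (-n) = β n := fun n => tsum_congr fun y => by rw [hqn]
  refine ⟨hαsumN, fun θ => ?_⟩
  -- regroup the sum over `ℤ³` by slabs
  have hterm : ∀ (n : ℤ) (y : Fin 2 → ℤ), q (Fin.insertNth i n y) *
      Real.cos (phase 3 (Fin.insertNth i θ k₀ : Fin 3 → ℝ) (Fin.insertNth i n y : Site 3)) =
      Real.cos (n * θ) * (q (Fin.insertNth i n y) * Real.cos (phase 2 k₀ y)) -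
        Real.sin (n * θ) * (q (Fin.insertNth i n y) * Real.sin (phase 2 k₀ y)) := by
    intro n y
    rw [phase_insertNth_insertNth, mul_comm θ, Real.cos_add]; ring
  have hF : ∀ n : ℤ, HasSum (fun y : Fin 2 → ℤ => q (Fin.insertNth i n y) *
      Real.cos (phase 3 (Fin.insertNth i θ k₀ : Fin 3 → ℝ) (Fin.insertNth i n y : Site 3)))
      (Real.cos (n * θ) * α n - Real.sin (n * θ) * β n) := by
    intro n
    simp_rw [hterm]
    have hc : Summable fun y : Fin 2 → ℤ => q (Fin.insertNth i n y) * Real.cos (phase 2 k₀ y) :=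
      Summable.of_norm_bounded (hrow n) fun y => by
        rw [Real.norm_eq_abs, abs_mul, abs_of_nonneg (hq0 _)]
        exact mul_le_of_le_one_right (hq0 _) (Real.abs_cos_le_one _)
    have hs : Summable fun y : Fin 2 → ℤ => q (Fin.insertNth i n y) * Real.sin (phase 2 k₀ y) :=
      Summable.of_norm_bounded (hrow n) fun y => by
        rw [Real.norm_eq_abs, abs_mul, abs_of_nonneg (hq0 _)]
        exact mul_le_of_le_one_right (hq0 _) (Real.abs_sin_le_one _)
    exact (hc.hasSum.mul_left _).sub (hs.hasSum.mul_left _)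
  have htot : HasSum (fun x : Site 3 => q x * Real.cos (phase 3 (Fin.insertNth i θ k₀ : Fin 3 → ℝ) x))
      (∑' x : Site 3, q x * Real.cos (phase 3 (Fin.insertNth i θ k₀ : Fin 3 → ℝ) x)) :=
    (Summable.of_norm_bounded hqs (fun x => by
      rw [Real.norm_eq_abs, abs_mul, abs_of_nonneg (hq0 _)]
      exact mul_le_of_le_one_right (hq0 _) (Real.abs_cos_le_one _))).hasSum
  have htot2 : HasSum (fun p : ℤ × (Fin 2 → ℤ) => q (Fin.insertNth i p.1 p.2) *
      Real.cos (phase 3 (Fin.insertNth i θ k₀ : Fin 3 → ℝ) (Fin.insertNth i p.1 p.2 : Site 3)))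
      (∑' x : Site 3, q x * Real.cos (phase 3 (Fin.insertNth i θ k₀ : Fin 3 → ℝ) x)) := by
    have := (e.hasSum_iff (f := fun x : Site 3 => q x * Real.cos (phase 3 (Fin.insertNth i θ k₀ : Fin 3 → ℝ) x))).2 htot
    simpa only [Function.comp_def, he_apply] using this
  have hZ : HasSum (fun n : ℤ => Real.cos (n * θ) * α n - Real.sin (n * θ) * β n)
      (∑' x : Site 3, q x * Real.cos (phase 3 (Fin.insertNth i θ k₀ : Fin 3 → ℝ) x)) :=
    htot2.prod_fiberwise hF
  -- pair `n` with `-n`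
  have hN := hZ.nat_add_neg
  have hpair : ∀ n : ℕ, (Real.cos ((n : ℤ) * θ) * α n - Real.sin ((n : ℤ) * θ) * β n) +
      (Real.cos (((-(n : ℤ) : ℤ)) * θ) * α (-(n : ℤ)) - Real.sin (((-(n : ℤ) : ℤ)) * θ) * β (-(n : ℤ))) =
      2 * α n * Real.cos (n * θ) := by
    intro n
    rw [hαneg, hβneg]
    push_cast
    rw [neg_mul, Real.cos_neg, Real.sin_neg]
    ring
  simp only [hpair, Int.cast_zero, zero_mul, Real.cos_zero, one_mul, Real.sin_zero, zero_mul, sub_zero] at hN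
  -- assemble the cosine series of `1 - φ`
  have h1 : HasSum (fun n : ℕ => (if n = 0 then (1 + α 0) else 0) - 2 * α n * Real.cos (n * θ))
      ((1 + α 0) - ((∑' x : Site 3, q x * Real.cos (phase 3 (Fin.insertNth i θ k₀ : Fin 3 → ℝ) x)) + α 0)) :=
    (hasSum_ite_eq 0 (1 + α 0)).sub hN
  have hval : (1 + α 0) - ((∑' x : Site 3, q x * Real.cos (phase 3 (Fin.insertNth i θ k₀ : Fin 3 → ℝ) x)) + α 0) =
      1 - ∑' x : Site 3, q x * Real.cos (phase 3 (Fin.insertNth i θ k₀ : Fin 3 → ℝ) x) := by ring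
  rw [hval] at h1
  refine h1.congr_fun fun n => ?_
  rcases Nat.eq_zero_or_pos n with hn | hn
  · subst hn; simp [hα]; ring
  · rw [if_neg hn.ne', if_neg hn.ne', zero_sub, hα]; push_cast; ring

/-- **Registered auxiliary stub `stub_pickInversion_auxSymbolSlab`** (sub-goal of `stub_pickInversion`):
the precision symbol at fixed transverse momentum as a cosine series in the longitudinal angle
(`hasSum_symbol_slab`). [folklore] -/
theorem stub_pickInversion_auxSymbolSlab : ∀ (q : Site 3 → ℝ) (i : Fin 3) (k₀ : Fin 2 → ℝ) (θ : ℝ),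
    (∀ y, 0 ≤ q y) → Summable q → (∀ y : Site 3, q (Function.update y i (-y i)) = q y) →
    HasSum (fun n : ℕ => (if n = 0 then 1 - ∑' y : Fin 2 → ℤ, q (Fin.insertNth i (0 : ℤ) y) * Real.cos (∑ j, k₀ j * (y j : ℝ))
        else -2 * ∑' y : Fin 2 → ℤ, q (Fin.insertNth i (n : ℤ) y) * Real.cos (∑ j, k₀ j * (y j : ℝ))) * Real.cos (n * θ))
      (1 - ∑' x : Site 3, q x * Real.cos (∑ j, (Fin.insertNth i θ k₀ : Fin 3 → ℝ) j * (x j : ℝ))) :=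
  fun _ i k₀ θ hq0 hqs hqrefl => by
    have h := (hasSum_symbol_slab hq0 hqs i hqrefl k₀).2 θ
    simpa only [phase] using h

end Summit.CriticalPhenomena.Ising3DConformalLimit.Cruxes.DirectCorrelationStableTail.SelfEnergyPickInversion

end
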